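import Summits.AtomisticToContinuum.Crystallization.Theorems.ChartedZeroExcessLayeredLatticeLiouvilleZZZYC
import Summits.AtomisticToContinuum.Crystallization.Theorems.ChartedZeroExcessLayeredLatticeLiouvilleZZZYD

/-!
# ChartedZeroExcess · LayeredLatticeLiouville ZZZYE (lens-2 g91 NODE 91 part 3 «MoatRouting») — the frame of ONE moat site is carried to EVERY site
# of the wide zone `{p ∈ S | ∀ k ∈ K, 8 < dist p k, ∃ k ∈ K, dist p k < 22.3}` through the moat `M = moatIn S K 8 20` (`K ⊆ B̄(x₀, 4)`, `K ≠ ∅`),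
# with an EXPLICIT agreement budget: N3 of PLAN-g91-SC (critic rows 1613/1615/1618) for the kinematic leaf (SC♮′) of `mildCoherentMoatCorePG_W2e_exactWell`.
Setting (section variables): a label map `Ψ`, a rotation field `Q`, the COHERENT FIT `hfit : ∀ x ∈ M, ∀ p ∈ S, dist p x ≤ 4 → dist (Q x (p − x)) (Ψ p − Ψ x) ≤ ϑ`
(= clause 3 of `IsCoherentTameOn ϑ S H M`), clean stars `hgood`, the hard core `IsSep (27/32) S`, and a reading frame `(U, t)`.  AGREEMENT of a site `y`
at level `G`: `∀ v, dist v x₀ ≤ 27 → dist (U (v − t)) (Ψ y + Q y (v − y)) ≤ G`; one bonded hop costs `c := ϑ(1 + 20·27) = 541ϑ` (`agree_hop`, ZZZYC).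
* `mem_moatIn_of_shell`: sites with `12 < dist(·, x₀) < 16` are moat sites;
* `moat_sphere_transport` (+28100c): along the 281 slerp way-points of the sphere of radius `14` (`sphere_waypoints`, ZZZYD; `frame_walk`, ZZZYC) agreement is
  carried from a site within `1` of a sphere point `P` to a site within `4/5` of any sphere point `T`;
* `moat_ray_transport` (+5100c): from a site within `1` of the radial point `x₀ + (14/dist y x₀)(y − x₀)` down/up the ray to the BASE ATOM `y` ITSELF
  (`9.05 ≤ dist y k ∀ k`, `dist y k₁ ≤ 14.5 ∃ k₁`; ray way-points + `dist_ray_between`, sites along the segment have `8.05 ≤ Φ ≤ 19`; arrival by `eq_of_dist_lt_four_fifths`);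
* `moat_descent_transport` (+n·c, n ≤ 12): K-DESCENT tracking ONE witness atom (`dist x k₁ ≤ 29/2 + n·9/20 ∧ < 20`), `clean_hop_far` (−9/20 per hop, bond ≤ 17/16),
  stops at the first site with some `dist ≤ 29/2`; no nearest-atom device, no finiteness of `K` used;
* `zone_anchor` (the three cases (Z-in/mid/out)): every wide-zone atom `p` is within `4` of an ANCHOR `x ∈ S` with `9.05 ≤ dist x k ∀ k` and `dist x k₁ < 19.9 ∃ k₁`
  ((Z-in) `outward_push` + COV: `dist z k > 10.67`, anchor `> 9.87`, `< 12.85`; (Z-mid) `x = p`; (Z-out) push `16/5` toward `k₁` + COV: `< 22.3 − 3.2 + 0.8 = 19.9`, `≥ 19.9 − 4`);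
* ★★ `zone_agreement`: master site `xs` within `1` of a sphere point at agreement `G` ⇒ every wide-zone atom `p` has an anchor `x ∈ M`, `dist p x ≤ 4`, at agreement
  `G + 33212·c` (`33212 = 28100 + 5100 + 12`).
0 sorry · imports = ZZZYC (91a) + ZZZYD (91b) · 0 defs · no instances/notation/options · axioms standard. [g91]
-/

noncomputable section

open scoped BigOperators RealInnerProductSpace
open MeasureTheory Set Metric Filter Topology
open Summit.AtomisticToContinuum.Crystallization.Theorems.ChartedPlanarOrderRigidityDoor (E3)
open Summit.AtomisticToContinuum.Crystallization.Theorems.ChartedPlanarOrderDensityDichotomy (IsSep)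
open Literature.Geometry.DiscreteGeometry (IsTwoShellGoodSet)

namespace Summit.AtomisticToContinuum.Crystallization.Theorems.ChartedZeroExcessLayeredLatticeLiouville

section Routing

variable {S K : Set E3} {x₀ : E3} {Ψ : E3 → E3} {Q : E3 → (E3 ≃ₗᵢ[ℝ] E3)} {ϑ : ℝ} {U : E3 ≃ₗᵢ[ℝ] E3} {t : E3}

/-- SHELL SAFETY (PROVED): a site with `12 < dist(y, x₀) < 16` is a moat site (`K ⊆ B̄(x₀, 4)`, `K ≠ ∅`: `8 < dist y k < 20`). [g91] -/
theorem mem_moatIn_of_shell (hK : ∀ k ∈ K, dist k x₀ ≤ 4) (hKne : K.Nonempty) {y : E3} (hy : y ∈ S) (h12 : 12 < dist y x₀)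
    (h16 : dist y x₀ < 16) : y ∈ moatIn S K 8 20 := by
  obtain ⟨k₀, hk₀⟩ := hKne
  refine ⟨hy, ⟨k₀, hk₀, ?_⟩, fun k hk => ?_⟩
  · linarith [dist_triangle y x₀ k₀, dist_comm x₀ k₀, hK k₀ hk₀]
  · linarith [dist_triangle y k x₀, hK k hk]

/-- the radial point of `y` on the sphere of radius `14` about `x₀`. [g91] -/
theorem dist_radialPoint (x₀ y : E3) (hy : 0 < dist y x₀) : dist (x₀ + (14 / dist y x₀) • (y - x₀)) x₀ = 14 := by
  rw [dist_eq_norm, add_sub_cancel_left, norm_smul, Real.norm_of_nonneg (by positivity), ← dist_eq_norm, div_mul_cancel₀ _ hy.ne']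

/-- ★ SPHERE TRANSPORT (PROVED, +28100·c): agreement is carried from a site within `1` of a point `P` of the sphere of radius `14` to a site within `4/5` of any
other point `T` of that sphere, along `sphere_waypoints` (281 points, spacing `≤ 1/5`, all at radius `14 ≤ 27 − 1`; sites within `1` of them have
`13 ≤ dist(·, x₀) ≤ 15`, hence are moat sites). [g91] -/
theorem moat_sphere_transport (hϑ : 0 ≤ ϑ) (hfit : ∀ x ∈ moatIn S K 8 20, ∀ p ∈ S, dist p x ≤ 4 → dist ((Q x) (p - x)) (Ψ p - Ψ x) ≤ ϑ)
    (hgood : ∀ q ∈ S, IsTwoShellGoodSet (1 / 16) (9 / 10) 1 S q) (hK : ∀ k ∈ K, dist k x₀ ≤ 4) (hKne : K.Nonempty) {P T : E3}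
    (hP : dist P x₀ = 14) (hT : dist T x₀ = 14) {G : ℝ} {q : E3} (hq : q ∈ S) (hqP : dist q P ≤ 1)
    (hG : ∀ v : E3, dist v x₀ ≤ 27 → dist (U (v - t)) (Ψ q + Q q (v - q)) ≤ G) :
    ∃ q' ∈ S, dist q' T < 4 / 5 ∧
      ∀ v : E3, dist v x₀ ≤ 27 → dist (U (v - t)) (Ψ q' + Q q' (v - q')) ≤ G + 28100 * (ϑ * (1 + 20 * 27)) := by
  obtain ⟨w, hw0, hwN, hwr, hws⟩ := sphere_waypoints x₀ (by norm_num : (0 : ℝ) < 14) hP hT (N := 280) (by norm_num)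
  have hwR : ∀ j, j ≤ 280 → dist (w j) x₀ ≤ 27 - 1 := fun j _ => by rw [hwr j]; norm_num
  have hsafe : ∀ j, j ≤ 280 → ∀ y ∈ S, dist y (w j) ≤ 1 → y ∈ moatIn S K 8 20 := fun j _ y hy hyw =>
    mem_moatIn_of_shell hK hKne hy (by linarith [hwr j, dist_triangle (w j) y x₀, dist_comm (w j) y])
      (by linarith [hwr j, dist_triangle y (w j) x₀])
  have hstep : ∀ j, j < 280 → dist (w (j + 1)) (w j) ≤ 1 / 5 := fun j _ => (hws j).trans (by norm_num)
  have hq0 : dist q (w 0) ≤ 1 := by rw [hw0]; exact hqP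
  obtain ⟨q', hq', hd, hG'⟩ := frame_walk hϑ hfit hgood hwR hsafe hstep hq hq0 hG 280 le_rfl
  refine ⟨q', hq', by rw [← hwN]; exact hd, fun v hv => (hG' v hv).trans_eq ?_⟩
  push_cast; ring

/-- ★ RAY TRANSPORT (PROVED, +5100·c): agreement is carried from a site within `1` of the radial point of a BASE ATOM `y ∈ S` (`181/20 ≤ dist y k` for all
`k ∈ K`, `dist y k₁ ≤ 29/2` for some) down/up the ray to `y` ITSELF: `5 ≤ dist y x₀ ≤ 37/2`, 51 ray way-points `x₀ + σ_j u_y` (`σ` between `14` and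
`dist y x₀`, spacing `≤ 1/5`, radius `≤ 37/2 ≤ 26`), sites within `1` of them are moat sites (`dist_ray_between`: along the segment `min(10, 9.05) ≤ dist(·, k)`,
`dist(·, k₁) ≤ max(18, 14.5)`), and the arrival site within `4/5` of `y` IS `y` (`eq_of_dist_lt_four_fifths`). [g91] -/
theorem moat_ray_transport (hϑ : 0 ≤ ϑ) (hfit : ∀ x ∈ moatIn S K 8 20, ∀ p ∈ S, dist p x ≤ 4 → dist ((Q x) (p - x)) (Ψ p - Ψ x) ≤ ϑ)
    (hgood : ∀ q ∈ S, IsTwoShellGoodSet (1 / 16) (9 / 10) 1 S q) (hsep : IsSep (27 / 32) S) (hK : ∀ k ∈ K, dist k x₀ ≤ 4) {y : E3} (hy : y ∈ S)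
    (hlo : ∀ k ∈ K, 181 / 20 ≤ dist y k) (hhi : ∃ k ∈ K, dist y k ≤ 29 / 2) {G : ℝ} {q : E3} (hq : q ∈ S)
    (hqP : dist q (x₀ + (14 / dist y x₀) • (y - x₀)) ≤ 1) (hG : ∀ v : E3, dist v x₀ ≤ 27 → dist (U (v - t)) (Ψ q + Q q (v - q)) ≤ G) :
    ∀ v : E3, dist v x₀ ≤ 27 → dist (U (v - t)) (Ψ y + Q y (v - y)) ≤ G + 5100 * (ϑ * (1 + 20 * 27)) := by
  obtain ⟨k₁, hk₁, hyk₁⟩ := hhi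
  obtain ⟨r, hr⟩ : ∃ r : ℝ, r = dist y x₀ := ⟨_, rfl⟩
  have hr5 : 5 ≤ r := by rw [hr]; linarith [hlo k₁ hk₁, dist_triangle y x₀ k₁, dist_comm x₀ k₁, hK k₁ hk₁]
  have hr18 : r ≤ 37 / 2 := by rw [hr]; linarith [dist_triangle y k₁ x₀, hK k₁ hk₁]
  have hr0 : 0 < r := by linarith
  obtain ⟨u, hu_def⟩ : ∃ u : E3, u = r⁻¹ • (y - x₀) := ⟨_, rfl⟩
  have hu : ‖u‖ = 1 := by
    rw [hu_def, norm_smul, norm_inv, Real.norm_of_nonneg hr0.le, ← dist_eq_norm, ← hr, inv_mul_cancel₀ hr0.ne']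
  have hyu : x₀ + r • u = y := by rw [hu_def, smul_smul, mul_inv_cancel₀ hr0.ne', one_smul]; abel
  have hPu : x₀ + (14 / dist y x₀) • (y - x₀) = x₀ + (14 : ℝ) • u := by rw [← hr, hu_def, smul_smul, div_eq_mul_inv]
  have hs : |r - 14| ≤ 10 := by rw [abs_le]; constructor <;> linarith
  obtain ⟨w, σ, hw, hσ0, hσN, hσb, hws⟩ := ray_waypoints x₀ u hu hs
  have hσlo : ∀ j, j ≤ 50 → 5 ≤ σ j := fun j hj => le_trans (le_min (by norm_num) hr5) (hσb j hj).1
  have hσhi : ∀ j, j ≤ 50 → σ j ≤ 37 / 2 := fun j hj => (hσb j hj).2.trans (max_le (by norm_num) hr18)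
  have hwR : ∀ j, j ≤ 50 → dist (w j) x₀ ≤ 27 - 1 := fun j hj => by
    rw [hw j, dist_eq_norm, add_sub_cancel_left, norm_smul, hu, mul_one, Real.norm_of_nonneg (by linarith [hσlo j hj])]
    linarith [hσhi j hj]
  have hP14 : dist (x₀ + (14 : ℝ) • u) x₀ = 14 := by
    rw [dist_eq_norm, add_sub_cancel_left, norm_smul, hu, mul_one, Real.norm_of_nonneg (by norm_num : (0 : ℝ) ≤ 14)]
  have hsafe : ∀ j, j ≤ 50 → ∀ y' ∈ S, dist y' (w j) ≤ 1 → y' ∈ moatIn S K 8 20 := by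
    intro j hj y' hy' hd
    have hb : ∀ k ∈ K, min (dist (x₀ + (14 : ℝ) • u) k) (dist (x₀ + r • u) k) ≤ dist (w j) k ∧
        dist (w j) k ≤ max (dist (x₀ + (14 : ℝ) • u) k) (dist (x₀ + r • u) k) := fun k hk => by
      rw [hw j]; exact dist_ray_between hu (hK k hk) (by norm_num) (by linarith) (hσb j hj).1 (hσb j hj).2
    refine ⟨hy', ⟨k₁, hk₁, ?_⟩, fun k hk => ?_⟩
    · have h1 := (hb k₁ hk₁).2
      rw [hyu] at h1
      have hPk : dist (x₀ + (14 : ℝ) • u) k₁ ≤ 18 := by linarith [dist_triangle (x₀ + (14 : ℝ) • u) x₀ k₁, dist_comm x₀ k₁, hK k₁ hk₁]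
      have h2 : dist (w j) k₁ ≤ 18 := h1.trans (max_le hPk (by linarith))
      linarith [dist_triangle y' (w j) k₁]
    · have h1 := (hb k hk).1
      rw [hyu] at h1
      have hPk : 10 ≤ dist (x₀ + (14 : ℝ) • u) k := by linarith [dist_triangle (x₀ + (14 : ℝ) • u) k x₀, hK k hk]
      have h2 : 181 / 20 ≤ dist (w j) k := (le_min (by linarith) (hlo k hk)).trans h1
      linarith [dist_triangle (w j) y' k, dist_comm (w j) y']
  have hstep : ∀ j, j < 50 → dist (w (j + 1)) (w j) ≤ 1 / 5 := fun j _ => hws j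
  have hq0 : dist q (w 0) ≤ 1 := by rw [hw 0, hσ0, ← hPu]; exact hqP
  obtain ⟨q', hq', hd, hG'⟩ := frame_walk hϑ hfit hgood hwR hsafe hstep hq hq0 hG 50 le_rfl
  have hq'y : q' = y := eq_of_dist_lt_four_fifths hsep hq' hy (by rw [hw 50, hσN, hyu] at hd; exact hd)
  intro v hv
  have h := hG' v hv
  rw [hq'y] at h
  refine h.trans_eq ?_
  push_cast; ring

/-- ★ K-DESCENT (PROVED, +n·c): from a site `x ∈ S` with `181/20 ≤ dist x k` for all `k ∈ K` and a WITNESS atom `k₁ ∈ K` with `dist x k₁ ≤ 29/2 + n·(9/20)`,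
`dist x k₁ < 20`, there is a BASE ATOM `y ∈ S` (`181/20 ≤ dist y k ∀ k`, `dist y k ≤ 29/2 ∃ k`) whose agreement at any level `G` transfers to `x` at
level `G + n·c`: induction on `n` — stop if some `dist x k ≤ 29/2`, else `clean_hop_far` toward `k₁` (gain `9/20`, bond `≤ 17/16`, all `dist(·, k)` stay
`> 29/2 − 17/16 > 181/20`, the witness stays `< 20`) and one `agree_hop` back (both ends are moat sites; `dist(x′, x₀) < 24 ≤ 27`). [g91] -/
theorem moat_descent_transport (hfit : ∀ x ∈ moatIn S K 8 20, ∀ p ∈ S, dist p x ≤ 4 → dist ((Q x) (p - x)) (Ψ p - Ψ x) ≤ ϑ)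
    (hgood : ∀ q ∈ S, IsTwoShellGoodSet (1 / 16) (9 / 10) 1 S q) (hK : ∀ k ∈ K, dist k x₀ ≤ 4) (hϑ : 0 ≤ ϑ) :
    ∀ n : ℕ, ∀ x ∈ S, (∀ k ∈ K, 181 / 20 ≤ dist x k) → (∃ k ∈ K, dist x k ≤ 29 / 2 + n * (9 / 20) ∧ dist x k < 20) →
      ∃ y ∈ S, (∀ k ∈ K, 181 / 20 ≤ dist y k) ∧ (∃ k ∈ K, dist y k ≤ 29 / 2) ∧
        ∀ G : ℝ, (∀ v : E3, dist v x₀ ≤ 27 → dist (U (v - t)) (Ψ y + Q y (v - y)) ≤ G) →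
          ∀ v : E3, dist v x₀ ≤ 27 → dist (U (v - t)) (Ψ x + Q x (v - x)) ≤ G + n * (ϑ * (1 + 20 * 27)) := by
  intro n
  induction n with
  | zero =>
    intro x hx hlo hw
    obtain ⟨k₁, hk₁, hle, -⟩ := hw
    exact ⟨x, hx, hlo, ⟨k₁, hk₁, by simpa using hle⟩, fun G hG v hv => (hG v hv).trans (by simp)⟩
  | succ n ih =>
    intro x hx hlo hw
    obtain ⟨k₁, hk₁, hle, hlt⟩ := hw
    by_cases hstop : ∃ k ∈ K, dist x k ≤ 29 / 2
    · refine ⟨x, hx, hlo, hstop, fun G hG v hv => (hG v hv).trans ?_⟩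
      have h0 : (0 : ℝ) ≤ ((n + 1 : ℕ) : ℝ) * (ϑ * (1 + 20 * 27)) := by positivity
      linarith
    · push Not at hstop
      have hfar : 3 ≤ dist x k₁ := by linarith [hstop k₁ hk₁]
      obtain ⟨x', hx', -, hxx', hprog⟩ := clean_hop_far (hgood x hx) hfar
      have hlo' : ∀ k ∈ K, 181 / 20 ≤ dist x' k := fun k hk => by linarith [hstop k hk, dist_triangle x x' k]
      have hle' : dist x' k₁ ≤ 29 / 2 + n * (9 / 20) := by push_cast at hle; linarith
      have hlt' : dist x' k₁ < 20 := by linarith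
      obtain ⟨y, hy, hylo, hyhi, hT⟩ := ih x' hx' hlo' ⟨k₁, hk₁, hle', hlt'⟩
      refine ⟨y, hy, hylo, hyhi, fun G hG => ?_⟩
      have hx'M : x' ∈ moatIn S K 8 20 := ⟨hx', ⟨k₁, hk₁, hlt'⟩, fun k hk => by linarith [hlo' k hk]⟩
      have hxM : x ∈ moatIn S K 8 20 := ⟨hx, ⟨k₁, hk₁, hlt⟩, fun k hk => by linarith [hlo k hk]⟩
      have hx'R : dist x' x₀ ≤ 27 := by linarith [dist_triangle x' k₁ x₀, hK k₁ hk₁]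
      have h := agree_hop hfit hx' (hgood x' hx') hx'M hxM (by rw [dist_comm]; linarith) hx'R (hT G hG)
      intro v hv
      refine (h v hv).trans_eq ?_
      push_cast; ring

/-- ★ THE ANCHOR OF A WIDE-ZONE ATOM (PROVED; the three cases (Z-in/mid/out) of PLAN-g91-SC): every `p ∈ S` with `8 < dist p k ∀ k ∈ K` and `dist p k₁ < 223/10`
for some `k₁ ∈ K` lies within `4` of an anchor `x ∈ S` with `181/20 ≤ dist x k ∀ k` and `dist x k < 199/10 ∃ k`.  (Z-in) `dist p k₀ < 181/20`: `outward_push`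
(`dist z k² > 114 > 10.67²`, `dist z k₀ ≤ dist p k₀ + 3`) and the COV atom within `4/5` of `z`; (Z-mid): `x = p`; (Z-out) all `dist p k ≥ 199/10`: the point `w`
at `16/5` from `p` toward `k₁` (`dist w k₁ = dist p k₁ − 16/5`) and the COV atom within `4/5` of `w`. [g91] -/
theorem zone_anchor (hsep : IsSep (27 / 32) S) (hgood : ∀ q ∈ S, IsTwoShellGoodSet (1 / 16) (9 / 10) 1 S q) (hK : ∀ k ∈ K, dist k x₀ ≤ 4) {p : E3}
    (hp : p ∈ S) (hplo : ∀ k ∈ K, 8 < dist p k) (hphi : ∃ k ∈ K, dist p k < 223 / 10) :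
    ∃ x ∈ S, dist p x ≤ 4 ∧ (∀ k ∈ K, 181 / 20 ≤ dist x k) ∧ ∃ k ∈ K, dist x k < 199 / 10 := by
  obtain ⟨k₁, hk₁, hpk₁⟩ := hphi
  by_cases hA : ∃ k ∈ K, dist p k < 181 / 20
  · obtain ⟨k₀, hk₀, hpk₀⟩ := hA
    have hp4 : 4 < dist p x₀ := by linarith [hplo k₀ hk₀, dist_triangle p x₀ k₀, dist_comm x₀ k₀, hK k₀ hk₀]
    obtain ⟨z, hzp, hz⟩ := outward_push x₀ p hp4
    obtain ⟨x, hx, hxz⟩ := exists_mem_dist_lt_four_fifths (by norm_num : (0 : ℝ) < 27 / 32) hsep hgood ⟨p, hp⟩ z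
    refine ⟨x, hx, ?_, fun k hk => ?_, ⟨k₀, hk₀, ?_⟩⟩
    · linarith [dist_triangle p z x, dist_comm p z, dist_comm z x]
    · obtain ⟨hsq, -⟩ := hz k (hK k hk) (hplo k hk)
      have hzk : 1067 / 100 < dist z k := by
        by_contra h
        rw [not_lt] at h
        nlinarith [dist_nonneg (x := z) (y := k), mul_le_mul h h dist_nonneg (by norm_num : (0 : ℝ) ≤ 1067 / 100)]
      linarith [dist_triangle z x k, dist_comm z x]
    · obtain ⟨-, hle⟩ := hz k₀ (hK k₀ hk₀) (hplo k₀ hk₀)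
      linarith [dist_triangle x z k₀]
  · push Not at hA
    by_cases hB : ∃ k ∈ K, dist p k < 199 / 10
    · exact ⟨p, hp, by rw [dist_self]; norm_num, hA, hB⟩
    · push Not at hB
      have hd0 : 0 < dist p k₁ := by linarith [hB k₁ hk₁]
      obtain ⟨w, hw⟩ : ∃ w : E3, w = p + ((16 / 5) / dist p k₁) • (k₁ - p) := ⟨_, rfl⟩
      have hc0 : 0 ≤ (16 / 5) / dist p k₁ := by positivity
      have hc1 : 0 ≤ 1 - (16 / 5) / dist p k₁ := by rw [sub_nonneg, div_le_one hd0]; linarith [hB k₁ hk₁]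
      have hpw : dist p w = 16 / 5 := by
        rw [hw, dist_eq_norm, sub_add_cancel_left, norm_neg, norm_smul, Real.norm_of_nonneg hc0, ← dist_eq_norm, dist_comm k₁ p,
          div_mul_cancel₀ _ hd0.ne']
      have hwk : dist w k₁ = dist p k₁ - 16 / 5 := by
        have e : w - k₁ = (1 - (16 / 5) / dist p k₁) • (p - k₁) := by rw [hw]; simp only [sub_smul, one_smul, smul_sub]; abel
        rw [dist_eq_norm, e, norm_smul, Real.norm_of_nonneg hc1, ← dist_eq_norm, sub_mul, one_mul, div_mul_cancel₀ _ hd0.ne']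
      obtain ⟨x, hx, hxw⟩ := exists_mem_dist_lt_four_fifths (by norm_num : (0 : ℝ) < 27 / 32) hsep hgood ⟨p, hp⟩ w
      refine ⟨x, hx, ?_, fun k hk => ?_, ⟨k₁, hk₁, ?_⟩⟩
      · linarith [dist_triangle p w x, dist_comm x w]
      · linarith [hB k hk, dist_triangle p x k, dist_triangle p w x, dist_comm x w]
      · linarith [dist_triangle x w k₁]

/-- ★★ ZONE AGREEMENT (PROVED; THE ROUTING): if a master site `xs ∈ S` within `1` of a point `P₀` of the sphere of radius `14` about `x₀` agrees with the reading
frame `(U, t)` at level `G`, then EVERY wide-zone atom `p` (`8 < dist p k ∀ k ∈ K`, `dist p k < 223/10 ∃ k`) is within `4` of an anchor `x ∈ moatIn S K 8 20`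
agreeing at level `G + 33212·ϑ(1 + 20·27)`: anchor (`zone_anchor`) ← K-descent with `n = 12` (`29/2 + 12·9/20 = 199/10`) from a base atom `y` ← ray from the
radial point of `y` ← sphere from `P₀`; `33212 = 28100 + 5100 + 12`. [g91] -/
theorem zone_agreement (hϑ : 0 ≤ ϑ) (hfit : ∀ x ∈ moatIn S K 8 20, ∀ p ∈ S, dist p x ≤ 4 → dist ((Q x) (p - x)) (Ψ p - Ψ x) ≤ ϑ)
    (hgood : ∀ q ∈ S, IsTwoShellGoodSet (1 / 16) (9 / 10) 1 S q) (hsep : IsSep (27 / 32) S) (hK : ∀ k ∈ K, dist k x₀ ≤ 4) {P₀ : E3}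
    (hP₀ : dist P₀ x₀ = 14) {xs : E3} (hxs : xs ∈ S) (hxsP : dist xs P₀ ≤ 1) {G : ℝ}
    (hG : ∀ v : E3, dist v x₀ ≤ 27 → dist (U (v - t)) (Ψ xs + Q xs (v - xs)) ≤ G) {p : E3} (hp : p ∈ S) (hplo : ∀ k ∈ K, 8 < dist p k)
    (hphi : ∃ k ∈ K, dist p k < 223 / 10) :
    ∃ x ∈ moatIn S K 8 20, dist p x ≤ 4 ∧
      ∀ v : E3, dist v x₀ ≤ 27 → dist (U (v - t)) (Ψ x + Q x (v - x)) ≤ G + 33212 * (ϑ * (1 + 20 * 27)) := by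
  have hKne : K.Nonempty := by obtain ⟨k, hk, -⟩ := hphi; exact ⟨k, hk⟩
  obtain ⟨x, hx, hpx, hxlo, k₁, hk₁, hxk₁⟩ := zone_anchor hsep hgood hK hp hplo hphi
  have hxM : x ∈ moatIn S K 8 20 := ⟨hx, ⟨k₁, hk₁, by linarith⟩, fun k hk => by linarith [hxlo k hk]⟩
  obtain ⟨y, hy, hylo, hyhi, hT⟩ :=
    moat_descent_transport hfit hgood hK hϑ 12 x hx hxlo ⟨k₁, hk₁, by push_cast; linarith, by linarith⟩
  have hy0 : 0 < dist y x₀ := by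
    obtain ⟨k, hk, _⟩ := hyhi
    linarith [hylo k hk, dist_triangle y x₀ k, dist_comm x₀ k, hK k hk]
  obtain ⟨q', hq', hd, hG'⟩ := moat_sphere_transport hϑ hfit hgood hK hKne hP₀ (dist_radialPoint x₀ y hy0) hxs hxsP hG
  have hGy := moat_ray_transport hϑ hfit hgood hsep hK hy hylo hyhi hq' (hd.le.trans (by norm_num)) hG'
  refine ⟨x, hxM, hpx, fun v hv => (hT _ hGy v hv).trans_eq ?_⟩
  push_cast; ring

end Routing

end Summit.AtomisticToContinuum.Crystallization.Theorems.ChartedZeroExcessLayeredLatticeLiouville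

end
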